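import Summits.AtomisticToContinuum.HydrodynamicLimit.Theorems.OneFlightGossipEngineEnergyCurrentTailsLevelCensusObjects
import Summits.AtomisticToContinuum.HydrodynamicLimit.Theorems.OneFlightGossipEngineEnergyCurrentTailsEnergyFluxCeilingRung0
import HarnessLib

/-!
# Crux `EnergyCurrentTails` (stmt-AtomisticToContinuum-9235), line `level-census-comparison`:
# the pair majorant of stub F2 — its kinematic class inclusion, and its value at rung 0

Helper file (`--supports stmt-AtomisticToContinuum-9235`) of stub F2 `stub_mergeCeiling : MergeCeiling`
of the line (objects of `…Theorems.OneFlightGossipEngineEnergyCurrentTailsLevelCensusObjects`).  It proves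
the DETERMINISTIC content of the pair majorant `pairMajorant`: a velocity event
`q = ((v₁⁻, v₂⁻), (v₁⁺, v₂⁺))` of the merge/spallation account `mergeEvent E Δ` (an up-crossing of the
level `E` with NO participant of pre-collisional energy in the band `(E − Δ, E]`) whose pair energy is
conserved lies in one of the arithmetic PAIR CLASSES of the majorant (`mergeEvent_subset_classes`,
registered helper; `0 < Δ` is the only hypothesis):

* MERGE (`aboveCount 0 → 1`): both pre-energies are `≤ E − Δ`, and since an outgoing energy exceeds
  `E` the total exceeds `E`; the FASTER participant lies in a class `(E − (k+1)Δ, E − kΔ]` with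
  `1 ≤ k ≤ ⌈E/(2Δ)⌉` (`k = ⌊(E − ‖v_fast‖²)/Δ⌋`, and `‖v_fast‖² > E/2`), the slower one is above the
  deficit `kΔ`;
* SPALLATION (`aboveCount 1 → 2`): the partner was above `E` and both outgoing energies exceed `E`,
  so the total exceeds `2E`; the crosser (pre-energy `≤ E − Δ`) lies in a class `((j−1)Δ, (j+1)Δ]`
  with `0 ≤ j ≤ ⌈E/Δ⌉` (`j = ⌈‖v_cross‖²/Δ⌉`), the partner is above `2E − (j+1)Δ`.

The memberships are stated particle-wise, in the set-builder shapes of `shellCensus` / `levelCensus`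
(`E₁ < ‖x‖² ∧ ‖x‖² ≤ E₂`, `Y < ‖x‖²`), for each of the two possible roles of the ordered pair, so that
an expected count of merge events is at most a sum of expected counts of pair-class events.  Corollaries:
the form for an elastic reflection `((v, w), reflectVel ω (v, w))` (any impact vector `ω`, energy is
conserved by `norm_sq_reflectVel_fst_add_norm_sq_reflectVel_snd`; for the collision records
`HardSphereCollisionRecord.ofConfig` of the tree use `ofConfig_norm_sq_preVel`) and the energy cap
`sq_le_of_mem_mergeEvent` (`maxPre ≤ 4E`: both pre-energies `≤ 4E`, so the relative speed is `≤ 4√E`,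
`norm_sub_le_four_sqrt` — the flux weight of the pair classes).  Pure real arithmetic (`Nat.floor` / `Nat.ceil` bracketing); no
dynamics, no measure theory.

The last section is the RUNG-0 STATICS of the same objects (constant profiles `a, θ̄ > 0`, `u`: the
homogeneous Gibbs law `G_N` is invariant under every flow, `lintegral_comp_flow_localGibbsLaw_const`, with
one-body velocity marginal `N(u, θ̄ I₃)`, `lintegral_vel_localGibbsLaw_drift`): at every time `r`,
`levelCensus(r, Y) = (N+1) N(u,θ̄){Y < ‖v‖²}`, `shellCensus(r, E₁, E₂) = (N+1) N(u,θ̄){E₁ < ‖v‖² ≤ E₂}`,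
hence `pairMajorant(r, E, Δ) = (N+1)² Σ (products of class probabilities)` (`pairMajorant_const`); plus
a small input of the rung-0 certificate of stub F2 (`…LevelCensusMergeCeilingRung0`): an empty window
carries no events (`eventSum_self`).

References: Cercignani–Illner–Pulvirenti 1994 §4 (collision records); the planner's card
`Ideas/level-census-comparison.md` (the census ledger and its accounts).
-/

noncomputable section

open MeasureTheory Set
open scoped ENNReal BigOperators

namespace Summit.AtomisticToContinuum.HydrodynamicLimit.Theorems.EnergyCurrentTailsLevelCensus

open Literature.MathematicalPhysics.KineticTheory Literature.Analysis.FluidPDE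

/-! ### The real-arithmetic core: one ordered pair of energies -/

/-- **Arithmetic core of the class inclusion.**  Pre-energies `b ≤ a` (the first participant is the
faster one), post-energies `a', b' ≥ 0` with `a' + b' = a + b`, an up-crossing of the level `E`
(the count above `E` increases), no pre-energy in the band `(E − Δ, E]`, `Δ > 0`.  Then either
(merge) `a ∈ (E − (k+1)Δ, E − kΔ]` and `kΔ < b` for some `1 ≤ k ≤ ⌈E/(2Δ)⌉`, or (spallation)
`b ∈ ((j−1)Δ, (j+1)Δ]` and `2E − (j+1)Δ < a` for some `0 ≤ j ≤ ⌈E/Δ⌉`. [folklore] -/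
theorem mergeClasses_real {E Δ a b a' b' : ℝ} (hΔ : 0 < Δ) (hb0 : 0 ≤ b) (ha'0 : 0 ≤ a')
    (hb'0 : 0 ≤ b') (hba : b ≤ a) (hsum : a' + b' = a + b)
    (hup : (if E < a then 1 else 0) + (if E < b then 1 else 0) <
      (if E < a' then 1 else 0) + (if E < b' then (1 : ℕ) else 0))
    (hna : ¬ (E - Δ < a ∧ a ≤ E)) (hnb : ¬ (E - Δ < b ∧ b ≤ E)) :
    (∃ k ∈ Finset.Icc 1 ⌈E / (2 * Δ)⌉₊,
        (E - ((k : ℝ) + 1) * Δ < a ∧ a ≤ E - (k : ℝ) * Δ) ∧ (k : ℝ) * Δ < b) ∨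
      (∃ j ∈ Finset.range (⌈E / Δ⌉₊ + 1),
        (((j : ℝ) - 1) * Δ < b ∧ b ≤ ((j : ℝ) + 1) * Δ) ∧ 2 * E - ((j : ℝ) + 1) * Δ < a) := by
  by_cases hEa : E < a
  · -- SPALLATION: the faster participant was already above `E`; the crosser is `b ≤ E - Δ`
    right
    have hEb : ¬ E < b := by
      intro hEb
      rw [if_pos hEa, if_pos hEb] at hup
      have h2 : (if E < a' then 1 else 0) + (if E < b' then (1 : ℕ) else 0) ≤ 2 := by
        split_ifs <;> simp
      omega
    rw [if_pos hEa, if_neg hEb] at hup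
    have hEa' : E < a' := by
      by_contra h
      rw [if_neg h] at hup
      split_ifs at hup <;> simp at hup
    have hEb' : E < b' := by
      by_contra h
      rw [if_pos hEa', if_neg h] at hup
      simp at hup
    have hbE : b ≤ E - Δ := by
      by_contra h
      exact hnb ⟨by linarith, not_lt.1 hEb⟩
    have htot : 2 * E < a + b := by linarith
    -- the crosser's class `j = ⌈b / Δ⌉`
    refine ⟨⌈b / Δ⌉₊, ?_, ?_, ?_⟩
    · rw [Finset.mem_range, Nat.lt_add_one_iff]
      exact Nat.ceil_mono ((div_le_div_iff_of_pos_right hΔ).2 (by linarith))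
    · have h0 : 0 ≤ b / Δ := div_nonneg hb0 hΔ.le
      have h1 : (⌈b / Δ⌉₊ : ℝ) < b / Δ + 1 := Nat.ceil_lt_add_one h0
      have h2 : b / Δ ≤ (⌈b / Δ⌉₊ : ℝ) := Nat.le_ceil _
      rw [div_add_one hΔ.ne', lt_div_iff₀ hΔ] at h1
      rw [div_le_iff₀ hΔ] at h2
      constructor
      · nlinarith
      · nlinarith
    · have h2 : b / Δ ≤ (⌈b / Δ⌉₊ : ℝ) := Nat.le_ceil _
      rw [div_le_iff₀ hΔ] at h2
      nlinarith
  · -- MERGE: both participants were `≤ E - Δ`; the faster one is in the class `k = ⌊(E - a) / Δ⌋`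
    left
    push Not at hEa
    have hEb : ¬ E < b := not_lt.2 (hba.trans hEa)
    rw [if_neg (not_lt.2 hEa), if_neg hEb] at hup
    have htot : E < a + b := by
      by_contra h
      push Not at h
      have h1 : ¬ E < a' := fun h1 => by linarith
      have h2 : ¬ E < b' := fun h2 => by linarith
      rw [if_neg h1, if_neg h2] at hup
      exact absurd hup (by decide)
    have haE : a ≤ E - Δ := by
      by_contra h
      exact hna ⟨by linarith, hEa⟩
    have ha2 : E / 2 < a := by linarith
    have hq0 : 0 ≤ (E - a) / Δ := div_nonneg (by linarith) hΔ.le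
    refine ⟨⌊(E - a) / Δ⌋₊, ?_, ?_, ?_⟩
    · rw [Finset.mem_Icc]
      constructor
      · refine Nat.le_floor ?_
        rw [Nat.cast_one, le_div_iff₀ hΔ]
        linarith
      · refine (Nat.floor_le_floor ?_).trans (Nat.floor_le_ceil _)
        rw [div_le_div_iff₀ hΔ (by positivity)]
        nlinarith
    · have h1 : ((⌊(E - a) / Δ⌋₊ : ℕ) : ℝ) ≤ (E - a) / Δ := Nat.floor_le hq0
      have h2 : (E - a) / Δ < ((⌊(E - a) / Δ⌋₊ : ℕ) : ℝ) + 1 := Nat.lt_floor_add_one _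
      rw [le_div_iff₀ hΔ] at h1
      rw [div_lt_iff₀ hΔ] at h2
      constructor
      · nlinarith
      · nlinarith
    · have h1 : ((⌊(E - a) / Δ⌋₊ : ℕ) : ℝ) ≤ (E - a) / Δ := Nat.floor_le hq0
      rw [le_div_iff₀ hΔ] at h1
      nlinarith

/-! ### The class inclusion for velocity events -/

/-- **Registered helper `mergeEvent_subset_classes` — the kinematic content of the pair majorant of
stub F2.**  Let `q = ((v₁⁻, v₂⁻), (v₁⁺, v₂⁺))` be a velocity event with conserved pair energy
`‖v₁⁺‖² + ‖v₂⁺‖² = ‖v₁⁻‖² + ‖v₂⁻‖²` (every elastic collision) in the merge/spallation account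
`mergeEvent E Δ` (up-crossing at `E`, no participant of pre-energy in `(E − Δ, E]`, faster participant
`≤ 4E`), `Δ > 0`.  Then EITHER (merge) for some `k ∈ [1, ⌈E/(2Δ)⌉]` one participant has pre-energy in
`(E − (k+1)Δ, E − kΔ]` and the other pre-energy above `kΔ`, OR (spallation) for some
`j ∈ [0, ⌈E/Δ⌉]` one participant has pre-energy in `((j−1)Δ, (j+1)Δ]` and the other above
`2E − (j+1)Δ` — the classes of `pairMajorant`, particle-wise, for both roles of the ordered pair. [folklore] -/
theorem mergeEvent_subset_classes : ∀ (E Δ : ℝ) (q : VelEvent), 0 < Δ →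
    ‖q.2.1‖ ^ 2 + ‖q.2.2‖ ^ 2 = ‖q.1.1‖ ^ 2 + ‖q.1.2‖ ^ 2 → q ∈ mergeEvent E Δ →
      (∃ k ∈ Finset.Icc 1 ⌈E / (2 * Δ)⌉₊,
        ((E - ((k : ℝ) + 1) * Δ < ‖q.1.1‖ ^ 2 ∧ ‖q.1.1‖ ^ 2 ≤ E - (k : ℝ) * Δ) ∧
            (k : ℝ) * Δ < ‖q.1.2‖ ^ 2) ∨
        ((E - ((k : ℝ) + 1) * Δ < ‖q.1.2‖ ^ 2 ∧ ‖q.1.2‖ ^ 2 ≤ E - (k : ℝ) * Δ) ∧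
            (k : ℝ) * Δ < ‖q.1.1‖ ^ 2)) ∨
      (∃ j ∈ Finset.range (⌈E / Δ⌉₊ + 1),
        ((((j : ℝ) - 1) * Δ < ‖q.1.1‖ ^ 2 ∧ ‖q.1.1‖ ^ 2 ≤ ((j : ℝ) + 1) * Δ) ∧
            2 * E - ((j : ℝ) + 1) * Δ < ‖q.1.2‖ ^ 2) ∨
        ((((j : ℝ) - 1) * Δ < ‖q.1.2‖ ^ 2 ∧ ‖q.1.2‖ ^ 2 ≤ ((j : ℝ) + 1) * Δ) ∧
            2 * E - ((j : ℝ) + 1) * Δ < ‖q.1.1‖ ^ 2)) := by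
  rintro E Δ ⟨⟨v, w⟩, ⟨v', w'⟩⟩ hΔ hsum ⟨⟨hup, hband⟩, -⟩
  simp only [upEvent, shellEvent, mem_setOf_eq, aboveCount, mem_compl_iff, not_or] at hup hband hsum ⊢
  obtain ⟨hnv, hnw⟩ := hband
  rcases le_total (‖w‖ ^ 2) (‖v‖ ^ 2) with hwv | hvw
  · -- the first participant is the faster one
    rcases mergeClasses_real hΔ (sq_nonneg _) (sq_nonneg _) (sq_nonneg _) hwv hsum hup hnv hnw with
      ⟨k, hk, hcls, hlev⟩ | ⟨j, hj, hcls, hlev⟩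
    · exact Or.inl ⟨k, hk, Or.inl ⟨hcls, hlev⟩⟩
    · exact Or.inr ⟨j, hj, Or.inr ⟨hcls, hlev⟩⟩
  · -- the second participant is the faster one: swap the roles
    have hsum' : ‖w'‖ ^ 2 + ‖v'‖ ^ 2 = ‖w‖ ^ 2 + ‖v‖ ^ 2 := by linarith
    have hup' : (if E < ‖w‖ ^ 2 then 1 else 0) + (if E < ‖v‖ ^ 2 then 1 else 0) <
        (if E < ‖w'‖ ^ 2 then 1 else 0) + (if E < ‖v'‖ ^ 2 then (1 : ℕ) else 0) := by
      rw [add_comm, add_comm (if E < ‖w'‖ ^ 2 then 1 else 0)]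
      exact hup
    rcases mergeClasses_real hΔ (sq_nonneg _) (sq_nonneg _) (sq_nonneg _) hvw hsum' hup' hnw hnv with
      ⟨k, hk, hcls, hlev⟩ | ⟨j, hj, hcls, hlev⟩
    · exact Or.inl ⟨k, hk, Or.inr ⟨hcls, hlev⟩⟩
    · exact Or.inr ⟨j, hj, Or.inl ⟨hcls, hlev⟩⟩

/-- **The class inclusion for an elastic reflection.**  For pre-collisional velocities `(v, w)` and
ANY impact vector `ω` (the reflection `reflectVel ω` conserves the pair energy; at `ω = 0` it is the
identity and the hypothesis is vacuous), if `((v, w), reflectVel ω (v, w)) ∈ mergeEvent E Δ` with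
`Δ > 0`, then `(v, w)` lies in one of the pair classes of `pairMajorant` (see
`mergeEvent_subset_classes`). [folklore] -/
theorem mergeEvent_subset_classes_reflectVel (E Δ : ℝ) (v w ω : V3) (hΔ : 0 < Δ)
    (h : ((v, w), reflectVel ω (v, w)) ∈ mergeEvent E Δ) :
    (∃ k ∈ Finset.Icc 1 ⌈E / (2 * Δ)⌉₊,
        ((E - ((k : ℝ) + 1) * Δ < ‖v‖ ^ 2 ∧ ‖v‖ ^ 2 ≤ E - (k : ℝ) * Δ) ∧ (k : ℝ) * Δ < ‖w‖ ^ 2) ∨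
        ((E - ((k : ℝ) + 1) * Δ < ‖w‖ ^ 2 ∧ ‖w‖ ^ 2 ≤ E - (k : ℝ) * Δ) ∧ (k : ℝ) * Δ < ‖v‖ ^ 2)) ∨
      (∃ j ∈ Finset.range (⌈E / Δ⌉₊ + 1),
        ((((j : ℝ) - 1) * Δ < ‖v‖ ^ 2 ∧ ‖v‖ ^ 2 ≤ ((j : ℝ) + 1) * Δ) ∧
            2 * E - ((j : ℝ) + 1) * Δ < ‖w‖ ^ 2) ∨
        ((((j : ℝ) - 1) * Δ < ‖w‖ ^ 2 ∧ ‖w‖ ^ 2 ≤ ((j : ℝ) + 1) * Δ) ∧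
            2 * E - ((j : ℝ) + 1) * Δ < ‖v‖ ^ 2)) :=
  mergeEvent_subset_classes E Δ ((v, w), reflectVel ω (v, w)) hΔ
    (norm_sq_reflectVel_fst_add_norm_sq_reflectVel_snd ω (v, w)) h

/-- Two speeds with squares at most `4E` differ by at most `4√E` (the flux weight of the capped pair
classes: `‖w − v‖ ≤ ‖v‖ + ‖w‖ ≤ 2√E + 2√E`). [folklore] -/
theorem norm_sub_le_four_sqrt {E : ℝ} {v w : V3} (hv : ‖v‖ ^ 2 ≤ 4 * E) (hw : ‖w‖ ^ 2 ≤ 4 * E) :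
    ‖w - v‖ ≤ 4 * Real.sqrt E := by
  have hs : Real.sqrt (4 * E) = 2 * Real.sqrt E := by
    rw [Real.sqrt_mul (by norm_num : (0 : ℝ) ≤ 4), show (4 : ℝ) = 2 ^ 2 by norm_num,
      Real.sqrt_sq (by norm_num : (0 : ℝ) ≤ 2)]
  have hv' : ‖v‖ ≤ 2 * Real.sqrt E := by
    rw [← hs]; exact Real.le_sqrt_of_sq_le hv
  have hw' : ‖w‖ ≤ 2 * Real.sqrt E := by
    rw [← hs]; exact Real.le_sqrt_of_sq_le hw
  calc ‖w - v‖ ≤ ‖w‖ + ‖v‖ := norm_sub_le _ _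
    _ ≤ 2 * Real.sqrt E + 2 * Real.sqrt E := add_le_add hw' hv'
    _ = 4 * Real.sqrt E := by ring

/-- On the merge/spallation account both PRE-collisional energies are at most `4E` (the cap
`maxPre ≤ 4E` of `mergeEvent`), so the relative speed is at most `4√E` (`norm_sub_le_four_sqrt`).
[folklore] -/
theorem sq_le_of_mem_mergeEvent {E Δ : ℝ} {q : VelEvent} (h : q ∈ mergeEvent E Δ) :
    ‖q.1.1‖ ^ 2 ≤ 4 * E ∧ ‖q.1.2‖ ^ 2 ≤ 4 * E := by
  obtain ⟨-, hcap⟩ := h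
  simpa only [mem_setOf_eq, maxPre, max_le_iff] using hcap

/-! ### Rung 0: the censuses and the pair majorant are Gaussian class probabilities, at every time -/

/-- **The expected census of a velocity class at rung 0**: for constant profiles, every flow, every `N`,
every time `r` and every measurable `S ⊆ V3`, `E_{G_N} #{i : vᵢ(r) ∈ S} = (N+1) · N(u,θ̄)(S)` (stationarity
of `G_N` under the flow and the one-body velocity marginal `N(u, θ̄ I₃)`). [folklore] -/
theorem lintegral_sum_indicator_flow_localGibbsLaw_const {σ : ℝ} (hσ : σ ≤ 1 / 2) {a θb : ℝ}
    (ha : 0 < a) (hθ : 0 < θb) (u : V3) (N : ℕ)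
    (Φ : HardSphereFlow (Torus.geometry (Fin 3)) (hsDiameter σ N) (N + 1)) (r : ℝ)
    {S : Set V3} (hS : MeasurableSet S) :
    ∫⁻ z, (∑ i : Fin (N + 1), S.indicator (fun _ => (1 : ℝ≥0∞)) ((Φ.flow r z i).2))
        ∂(localGibbsLaw σ (fun _ => a) (fun _ => u) (fun _ => θb) N Φ) =
      ((N + 1 : ℕ) : ℝ≥0∞) * gaussMeasure u θb S := by
  have hterm : ∀ i : Fin (N + 1), Measurable fun w : Config (N + 1) (Fin 3) T3 =>
      S.indicator (fun _ => (1 : ℝ≥0∞)) ((w i).2) :=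
    fun i => (measurable_const.indicator hS).comp (measurable_pi_apply i).snd
  have hgm : Measurable fun w : Config (N + 1) (Fin 3) T3 =>
      ∑ i : Fin (N + 1), S.indicator (fun _ => (1 : ℝ≥0∞)) ((w i).2) :=
    Finset.measurable_sum _ fun i _ => hterm i
  calc ∫⁻ z, (∑ i : Fin (N + 1), S.indicator (fun _ => (1 : ℝ≥0∞)) ((Φ.flow r z i).2))
        ∂(localGibbsLaw σ (fun _ => a) (fun _ => u) (fun _ => θb) N Φ)
      = ∫⁻ z, (∑ i : Fin (N + 1), S.indicator (fun _ => (1 : ℝ≥0∞)) ((z i).2))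
          ∂(localGibbsLaw σ (fun _ => a) (fun _ => u) (fun _ => θb) N Φ) :=
        lintegral_comp_flow_localGibbsLaw_const σ a θb u N Φ r hgm
    _ = ∑ i : Fin (N + 1), ∫⁻ z, S.indicator (fun _ => (1 : ℝ≥0∞)) ((z i).2)
          ∂(localGibbsLaw σ (fun _ => a) (fun _ => u) (fun _ => θb) N Φ) :=
        lintegral_finsetSum _ fun i _ => hterm i
    _ = ∑ _i : Fin (N + 1), gaussMeasure u θb S := by
        refine Finset.sum_congr rfl fun i _ => ?_
        rw [QuarticSchurLedger.lintegral_vel_localGibbsLaw_drift hσ ha hθ u N Φ i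
          (measurable_const.indicator hS), lintegral_indicator_const hS, one_mul]
    _ = ((N + 1 : ℕ) : ℝ≥0∞) * gaussMeasure u θb S := by
        rw [Finset.sum_const, Finset.card_univ, Fintype.card_fin, nsmul_eq_mul]

/-- **The level census at rung 0**: `levelCensus(r, Y) = (N+1) · N(u,θ̄){Y < ‖v‖²}` at every time `r`.
[folklore] -/
theorem levelCensus_const {σ : ℝ} (hσ : σ ≤ 1 / 2) {a θb : ℝ} (ha : 0 < a) (hθ : 0 < θb) (u : V3)
    (N : ℕ) (Φ : HardSphereFlow (Torus.geometry (Fin 3)) (hsDiameter σ N) (N + 1)) (r Y : ℝ) :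
    levelCensus σ (fun _ => a) (fun _ => θb) (fun _ => u) N Φ r Y =
      ((N + 1 : ℕ) : ℝ≥0∞) * gaussMeasure u θb {v : V3 | Y < ‖v‖ ^ 2} :=
  lintegral_sum_indicator_flow_localGibbsLaw_const hσ ha hθ u N Φ r
    (measurableSet_lt measurable_const (continuous_norm.measurable.pow_const 2))

/-- **The shell census at rung 0**: `shellCensus(r, E₁, E₂) = (N+1) · N(u,θ̄){E₁ < ‖v‖² ≤ E₂}` at every
time `r`. [folklore] -/
theorem shellCensus_const {σ : ℝ} (hσ : σ ≤ 1 / 2) {a θb : ℝ} (ha : 0 < a) (hθ : 0 < θb) (u : V3)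
    (N : ℕ) (Φ : HardSphereFlow (Torus.geometry (Fin 3)) (hsDiameter σ N) (N + 1)) (r E₁ E₂ : ℝ) :
    shellCensus σ (fun _ => a) (fun _ => θb) (fun _ => u) N Φ r E₁ E₂ =
      ((N + 1 : ℕ) : ℝ≥0∞) * gaussMeasure u θb {v : V3 | E₁ < ‖v‖ ^ 2 ∧ ‖v‖ ^ 2 ≤ E₂} :=
  lintegral_sum_indicator_flow_localGibbsLaw_const hσ ha hθ u N Φ r
    ((measurableSet_lt measurable_const (continuous_norm.measurable.pow_const 2)).inter
    (measurableSet_le (continuous_norm.measurable.pow_const 2) measurable_const))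

/-- **The pair majorant at rung 0** is `(N+1)²` times the sum of PRODUCTS of Gaussian class probabilities,
at every time `r`. [folklore] -/
theorem pairMajorant_const {σ : ℝ} (hσ : σ ≤ 1 / 2) {a θb : ℝ} (ha : 0 < a) (hθ : 0 < θb) (u : V3)
    (N : ℕ) (Φ : HardSphereFlow (Torus.geometry (Fin 3)) (hsDiameter σ N) (N + 1)) (r E Δ : ℝ) :
    pairMajorant σ (fun _ => a) (fun _ => θb) (fun _ => u) N Φ r E Δ =
      ((N + 1 : ℕ) : ℝ≥0∞) ^ 2 *
        ((∑ k ∈ Finset.Icc 1 ⌈E / (2 * Δ)⌉₊,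
            gaussMeasure u θb {v : V3 | E - ((k : ℝ) + 1) * Δ < ‖v‖ ^ 2 ∧ ‖v‖ ^ 2 ≤ E - (k : ℝ) * Δ} *
              gaussMeasure u θb {v : V3 | (k : ℝ) * Δ < ‖v‖ ^ 2}) +
          ∑ j ∈ Finset.range (⌈E / Δ⌉₊ + 1),
            gaussMeasure u θb {v : V3 | ((j : ℝ) - 1) * Δ < ‖v‖ ^ 2 ∧ ‖v‖ ^ 2 ≤ ((j : ℝ) + 1) * Δ} *
              gaussMeasure u θb {v : V3 | 2 * E - ((j : ℝ) + 1) * Δ < ‖v‖ ^ 2}) := by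
  simp only [pairMajorant, shellCensus_const hσ ha hθ, levelCensus_const hσ ha hθ, Finset.mul_sum,
    mul_add]
  congr 1 <;> exact Finset.sum_congr rfl fun _ _ => by ring

/-! ### A small input of the rung-0 certificate -/

/-- An empty window carries no velocity events. [folklore] -/
theorem eventSum_self {σ : ℝ} {N : ℕ} (Φ : Flow σ N) (s : ℝ) (S : Set VelEvent)
    (z : Config (N + 1) (Fin 3) T3) : eventSum Φ s s S z = 0 := by
  simp only [eventSum, HardSphereFlow.collisionSum_eq, collisionSum_eq_collisionPairSum, Set.Ioc_self,
    collisionPairSum_empty]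

end Summit.AtomisticToContinuum.HydrodynamicLimit.Theorems.EnergyCurrentTailsLevelCensus

end
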